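import Summits.CriticalPhenomena.SAWScalingLimit.Theses.SAWCompassLattice
import Summits.CriticalPhenomena.SAWScalingLimit.Theses.SAWParafermion
import Summits.CriticalPhenomena.SAWScalingLimit.Theses.SAWTrackTransport
import Summits.CriticalPhenomena.SAWScalingLimit.Theorems.SAWDevelopingMapHexTransferLineReduction
import Summits.CriticalPhenomena.SAWScalingLimit.Theorems.SAWCompassLatticeSurfaceUniversalityNonVacuity
import Summits.CriticalPhenomena.SAWScalingLimit.Theorems.SubseqIdentification.Negative.ProbabilityRedundant
import Literature.Probability.RandomPlanarGeometry.SLEConvergenceCriterion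
import Literature.Probability.RandomPlanarGeometry.PortGadgetLattice
import Mathlib.MeasureTheory.Measure.Portmanteau

/-!
# `TightToll`: the toll reduction for `SurfaceUniversality` (stmt-CriticalPhenomena-6964) with
# `ℤ²` TIGHTNESS in place of `YBSquareSLE` — sorry-free companion of the line `Lines/lipschitz_toll.lean`

`TollReduction.lean` (sibling workfile) records `YBSquareSLE → YBtoUniform → SurfaceUniversality`:
the deterministic `O(δ)` port coupling between the compass law and GM's Yang–Baxter law passes a
LIMIT, so at `C_b` level it needs the SLE(8/3) identification of GM's walk (`YBSquareSLE`,
stmt-6967). This file proves the alternative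

  `surfaceUniversality_of_tight_of_ybToUniform :
      SAWParafermion.EventualTight → SAWTrackTransport.YBtoUniform → SurfaceUniversality`

(stmt-1881 → stmt-16966 → stmt-6964), and in fact with `YBtoUniform` weakened to bounded LIPSCHITZ
test functions (`LipYBtoUniform`, `surfaceUniversality_of_tight_of_lipYBtoUniform`). Mechanism:

* `lipPortCoupling` — for bounded `L`-Lipschitz `f`, `‖∫ f∘curve d ybLaw(π/2) − ∫ f d compassLaw‖
  ≤ L·|δ|` (landed port dictionary `Sketch.stub_portDictionary`, landed push-forward identities
  `PortTransfer.ybLaw_eq_map` / `compassLaw_eq_map`, landed drawing coupling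
  `PortTransfer.dist_compassCurve_curve_le`): no limit, no tightness;
* `tendsto_sub_of_isTightAlongMesh` — ONE-SIDED Prokhorov upgrade: if one of two families of laws
  on the Polish space `CurveClass ℂ` is tight along `δ → 0⁺` (`IsTightAlongMesh`) and the two merge
  on bounded Lipschitz functions, they merge on all bounded continuous functions (subsequence
  principle + `IsTightAlongMesh.exists_subseq` + Mathlib's bounded-Lipschitz portmanteau
  `tendsto_iff_forall_lipschitz_integral_tendsto`); the second family's tightness is not needed.

Consequences for staffing: the hypothesis that upgrades Lipschitz merging to the crux is the shared
tightness item stmt-1881 (15 routes), not a statement about GM's walk; and `YBtoUniform` (16966)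
is needed only on Lipschitz observables. Landable verbatim under `Theorems/` with
`--supports stmt-CriticalPhenomena-6964` (sorry-free; `lean check` rc 0).
-/

noncomputable section

namespace Summit.CriticalPhenomena.SAWScalingLimit.Cruxes.SurfaceUniversality.TightToll

open MeasureTheory Filter Topology Set
open scoped NNReal ENNReal BoundedContinuousFunction
open Literature.Probability.RandomPlanarGeometry
open Literature.Probability.RandomPlanarGeometry.SAW
open Literature.Probability.RandomPlanarGeometry.SAW.YangBaxter
open Literature.Probability.LatticeModels (Site)
open Summit.CriticalPhenomena.SAWScalingLimit.Theses
open Summit.CriticalPhenomena.SAWScalingLimit.Cruxes.HexTransfer.Sketch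

/-! ### Generic: one-sided tightness upgrades bounded-Lipschitz merging to `C_b` merging -/

section Generic

variable {Ω : ℝ → Type*} [∀ δ, MeasurableSpace (Ω δ)]

/-- **One-sided Prokhorov upgrade.** Let `Y δ : Ω δ → CurveClass ℂ` be random curve classes under
laws `P δ` (probability measures making `Y δ` a.e.-measurable for small `δ`) forming a TIGHT family
along `δ → 0⁺`, and let `ν δ` be probability measures on `CurveClass ℂ` for small `δ` (NO tightness
assumed). If `E[g(Y δ)] − ∫ g dν δ → 0` for every bounded Lipschitz `g`, then
`E[f(Y δ)] − ∫ f dν δ → 0` for every bounded continuous `f`. Proof: by the subsequence principle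
it suffices to extract, from every sequence of meshes `s n → 0⁺`, a subsequence along which the
difference tends to `0`; Prokhorov along the mesh gives a subsequence with `Y ⇒ μ`; then `ν ⇒ μ`
on bounded Lipschitz functions, hence weakly (bounded-Lipschitz portmanteau), hence on `f`.
[cite: BillingsleyCPM1999, Thm. 5.1 and Thm. 2.6] -/
theorem tendsto_sub_of_isTightAlongMesh {Y : ∀ δ, Ω δ → CurveClass ℂ} {P : ∀ δ, Measure (Ω δ)}
    {ν : ℝ → Measure (CurveClass ℂ)}
    (hP : ∀ᶠ δ in 𝓝[>] (0 : ℝ), IsProbabilityMeasure (P δ))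
    (hY : ∀ᶠ δ in 𝓝[>] (0 : ℝ), AEMeasurable (Y δ) (P δ))
    (hT : IsTightAlongMesh Y P)
    (hν : ∀ᶠ δ in 𝓝[>] (0 : ℝ), IsProbabilityMeasure (ν δ))
    (hLip : ∀ (g : CurveClass ℂ →ᵇ ℝ) (L : ℝ≥0), LipschitzWith L g →
      Tendsto (fun δ => (∫ ω, g (Y δ ω) ∂P δ) - ∫ x, g x ∂ν δ) (𝓝[>] (0 : ℝ)) (𝓝 0))
    (f : CurveClass ℂ →ᵇ ℝ) :
    Tendsto (fun δ => (∫ ω, f (Y δ ω) ∂P δ) - ∫ x, f x ∂ν δ) (𝓝[>] (0 : ℝ)) (𝓝 0) := by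
  classical
  -- surrogate probability laws on the curve space, equal to the push-forward laws for small `δ`
  obtain ⟨ρ, hρ⟩ : ∃ ρ : ℝ → Measure (CurveClass ℂ), ∀ δ, ρ δ =
      if IsProbabilityMeasure ((P δ).map (Y δ)) then (P δ).map (Y δ)
      else Measure.dirac (CurveClass.mk (Curve.const 0)) :=
    ⟨_, fun _ => rfl⟩
  have hρprob : ∀ δ, IsProbabilityMeasure (ρ δ) := by
    intro δ
    by_cases h : IsProbabilityMeasure ((P δ).map (Y δ))
    · rw [hρ δ, if_pos h]
      exact h
    · rw [hρ δ, if_neg h]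
      infer_instance
  have hev : ∀ᶠ δ in 𝓝[>] (0 : ℝ), AEMeasurable (Y δ) (P δ) ∧ ρ δ = (P δ).map (Y δ) := by
    filter_upwards [hP, hY] with δ hPδ hYδ
    haveI := hPδ
    refine ⟨hYδ, ?_⟩
    rw [hρ δ, if_pos (Measure.isProbabilityMeasure_map hYδ)]
  have hTρ : IsTightAlongMesh (Ωδ := fun _ : ℝ => CurveClass ℂ)
      (fun (_ : ℝ) (x : CurveClass ℂ) => x) ρ := by
    intro ε hε
    obtain ⟨K, hK, hb⟩ := hT ε hε
    refine ⟨K, hK, ?_⟩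
    filter_upwards [hb, hev] with δ hδ hδ'
    have hpre : (fun x : CurveClass ℂ => x) ⁻¹' Kᶜ = Kᶜ := rfl
    rw [hpre, hδ'.2,
      Measure.map_apply_of_aemeasurable hδ'.1 hK.isClosed.isOpen_compl.measurableSet]
    exact hδ
  haveI : ∀ δ, IsProbabilityMeasure (ρ δ) := hρprob
  refine tendsto_of_subseq_tendsto fun s hs => ?_
  obtain ⟨φ, μ, hφ, hμ, hlim⟩ :=
    hTρ.exists_subseq (Filter.Eventually.of_forall fun δ => aemeasurable_id') hs
  refine ⟨φ, ?_⟩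
  have ht : Tendsto (fun n => s (φ n)) atTop (𝓝[>] (0 : ℝ)) := hs.comp hφ.tendsto_atTop
  -- (i) the tight side converges to `μ` along `s ∘ φ`, on every bounded continuous function
  have hA : ∀ g : CurveClass ℂ →ᵇ ℝ,
      Tendsto (fun n => ∫ ω, g (Y (s (φ n)) ω) ∂P (s (φ n))) atTop (𝓝 (∫ x, g x ∂μ)) := by
    intro g
    refine (hlim g).congr' ?_
    filter_upwards [ht.eventually hev] with n hn
    change ∫ x, g x ∂ρ (s (φ n)) = _
    rw [hn.2, integral_map hn.1 g.continuous.aestronglyMeasurable]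
  -- (ii) the other side converges to `μ` along `s ∘ φ`, on bounded Lipschitz functions
  have hB : ∀ (g : CurveClass ℂ →ᵇ ℝ) (L : ℝ≥0), LipschitzWith L g →
      Tendsto (fun n => ∫ x, g x ∂ν (s (φ n))) atTop (𝓝 (∫ x, g x ∂μ)) := by
    intro g L hL
    have h1 : Tendsto (fun n => (∫ ω, g (Y (s (φ n)) ω) ∂P (s (φ n))) - ∫ x, g x ∂ν (s (φ n)))
        atTop (𝓝 0) := (hLip g L hL).comp ht
    have h2 := (hA g).sub h1
    rw [sub_zero] at h2
    exact h2.congr fun n => sub_sub_cancel _ _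
  -- (iii) surrogate probability measures on the `ν` side; bounded-Lipschitz portmanteau
  let ν' : ℕ → ProbabilityMeasure (CurveClass ℂ) := fun n =>
    if h : IsProbabilityMeasure (ν (s (φ n))) then ⟨ν (s (φ n)), h⟩ else ⟨μ, hμ⟩
  have hν' : ∀ᶠ n in atTop, ((ν' n : ProbabilityMeasure (CurveClass ℂ)) : Measure (CurveClass ℂ))
      = ν (s (φ n)) := by
    filter_upwards [ht.eventually hν] with n hn
    show ((if h : IsProbabilityMeasure (ν (s (φ n))) then (⟨ν (s (φ n)), h⟩ : ProbabilityMeasure _)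
      else ⟨μ, hμ⟩ : ProbabilityMeasure (CurveClass ℂ)) : Measure (CurveClass ℂ)) = _
    rw [dif_pos hn]
    rfl
  have hweak : Tendsto ν' atTop (𝓝 (⟨μ, hμ⟩ : ProbabilityMeasure (CurveClass ℂ))) := by
    refine tendsto_iff_forall_lipschitz_integral_tendsto.2 fun g hgb hgl => ?_
    obtain ⟨L, hL⟩ := hgl
    let gb : CurveClass ℂ →ᵇ ℝ := ⟨⟨g, hL.continuous⟩, hgb⟩
    refine ((hB gb L hL).congr' ?_)
    filter_upwards [hν'] with n hn
    rw [hn]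
    rfl
  -- (iv) hence on `f`, and the difference tends to `∫ f dμ - ∫ f dμ = 0`
  have hC : Tendsto (fun n => ∫ x, f x ∂ν (s (φ n))) atTop (𝓝 (∫ x, f x ∂μ)) := by
    have h := (ProbabilityMeasure.tendsto_iff_forall_integral_tendsto.1 hweak) f
    refine h.congr' ?_
    filter_upwards [hν'] with n hn
    rw [hn]
  have h := (hA f).sub hC
  rwa [sub_self] at h

end Generic

/-! ### The proved leg: GM's Yang–Baxter law vs the compass law, on bounded Lipschitz functions -/

/-- **Port coupling at bounded-Lipschitz level, as an inequality.** For a solution of the compass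
equations, any domain `Ω`, mesh `δ`, ports `a, b` and a bounded `L`-Lipschitz `f`:
`‖∫ f (γ.curve) d ybLaw(π/2) Ω δ 1 a b − ∫ f d compassLaw α β s z Ω δ a b‖ ≤ L · |δ|`. Both laws are
push-forwards of ONE normalised compass path measure `ρ_δ` (landed `PortTransfer.ybLaw_eq_map`,
through the landed port dictionary `Sketch.stub_portDictionary`, and `PortTransfer.compassLaw_eq_map`)
along two drawings at distance `≤ |δ|` (`PortTransfer.dist_compassCurve_curve_le`); `ρ_δ` is `0`
or a probability measure. No limit, no tightness. [folklore] -/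
theorem norm_integral_yb_sub_compass_le {α β s z : ℝ} (hsol : IsCompassSolution α β s z)
    (Ω : Set ℂ) (δ : ℝ) (a b : MidEdge) (f : CurveClass ℂ →ᵇ ℝ) {L : ℝ≥0}
    (hf : LipschitzWith L f) :
    ‖(∫ γ, f (γ.curve rightAngles δ) ∂(ybLaw rightAngles Ω δ 1 a b)) -
        ∫ x, f x ∂(SAW.compassLaw α β s z Ω δ a b)‖ ≤ L * |δ| := by
  have hP : SAWCompassLattice.PortDictionary :=
    Summit.CriticalPhenomena.SAWScalingLimit.Cruxes.HexTransfer.Sketch.stub_portDictionary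
  have h1 : ∫ γ, f (γ.curve rightAngles δ) ∂(ybLaw rightAngles Ω δ 1 a b) =
      ∫ p, f ((PortTransfer.toYB hP hsol p).curve rightAngles δ)
        ∂(PortTransfer.compassRho α β s z Ω δ a b) := by
    change ∫ γ, f (γ.curve (fun (_ : ℤ) => Real.pi / 2) δ)
        ∂(ybLaw (fun (_ : ℤ) => Real.pi / 2) Ω δ 1 a b) = _
    rw [PortTransfer.ybLaw_eq_map hP hsol,
      integral_map (PortTransfer.measurable_cpath _).aemeasurable]
    exact (YBWalk.measurable_of_top _).aestronglyMeasurable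
  have h2 : ∫ x, f x ∂(SAW.compassLaw α β s z Ω δ a b) =
      ∫ p, f (PortTransfer.compassCurve δ p) ∂(PortTransfer.compassRho α β s z Ω δ a b) := by
    change ∫ x, f x ∂(PortTransfer.compassLaw α β s z Ω δ a b) = _
    rw [PortTransfer.compassLaw_eq_map,
      integral_map (PortTransfer.measurable_cpath _).aemeasurable f.continuous.aestronglyMeasurable]
  rw [h1, h2, ← norm_neg, neg_sub]
  have key := PortTransfer.norm_integral_sub_integral_le (ε := |δ|)
    (PortTransfer.compassRho_zero_or_prob α β s z Ω δ a b)
    (PortTransfer.measurable_cpath _).aemeasurable (PortTransfer.measurable_cpath _).aemeasurable f hf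
    (fun p => PortTransfer.dist_compassCurve_curve_le p (PortTransfer.toYB hP hsol p)
      (PortTransfer.toYB_mids hP hsol p))
  rwa [abs_abs] at key

/-- **The proved leg along `δ → 0⁺`**: GM's critical square-tiling law and the compass chordal law
merge on bounded Lipschitz test functions, for every solution of the compass equations, EVERY
domain and EVERY family of ports (no endpoint approximation, no limit, no tightness). [folklore] -/
theorem lipPortCoupling {α β s z : ℝ} (hsol : IsCompassSolution α β s z) (Ω : Set ℂ)
    (a b : ℝ → MidEdge) (f : CurveClass ℂ →ᵇ ℝ) {L : ℝ≥0} (hf : LipschitzWith L f) :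
    Tendsto (fun δ : ℝ => (∫ γ, f (γ.curve rightAngles δ) ∂(ybLaw rightAngles Ω δ 1 (a δ) (b δ))) -
        ∫ x, f x ∂(SAW.compassLaw α β s z Ω δ (a δ) (b δ))) (𝓝[>] (0 : ℝ)) (𝓝 0) := by
  have hε : Tendsto (fun δ : ℝ => (L : ℝ) * |δ|) (𝓝[>] (0 : ℝ)) (𝓝 0) := by
    have h0 : Tendsto (fun δ : ℝ => |δ|) (𝓝[>] (0 : ℝ)) (𝓝 0) :=
      (continuous_abs.tendsto' (0 : ℝ) 0 abs_zero).mono_left nhdsWithin_le_nhds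
    simpa using (tendsto_const_nhds (x := (L : ℝ))).mul h0
  exact squeeze_zero_norm (fun δ => norm_integral_yb_sub_compass_le hsol Ω δ (a δ) (b δ) f hf) hε

/-! ### The reductions -/

/-- `SAWTrackTransport.YBtoUniform` (stmt-CriticalPhenomena-16966) restricted to bounded Lipschitz
test functions: the `ℤ²` law vs GM's square-tiling law. [folklore] -/
def LipYBtoUniform : Prop :=
  ∀ (D : DobrushinDomain) (a b : ℝ → Site 2) (a' b' : ℝ → MidEdge),
    SAW.IsEndpointApprox D a b → IsYBEndpointApprox rightAngles D a' b' →
    ∀ (f : BoundedContinuousFunction (CurveClass ℂ) ℝ) (L : ℝ≥0), LipschitzWith L f →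
      Tendsto (fun δ : ℝ => (∫ γ, f γ.curve ∂(SAW.law D.carrier δ (a δ) (b δ))) -
          ∫ γ, f (γ.curve rightAngles δ) ∂(ybLaw rightAngles D.carrier δ 1 (a' δ) (b' δ)))
        (𝓝[>] (0 : ℝ)) (𝓝 0)

/-- The `C_b` toll `YBtoUniform` (stmt-16966) trivially gives its Lipschitz restriction. [folklore] -/
theorem lipYBtoUniform_of_ybToUniform (h : SAWTrackTransport.YBtoUniform) : LipYBtoUniform :=
  fun D a b a' b' hab hab' f _ _ => h D a b a' b' hab hab' f

/-- **The toll reduction WITHOUT `YBSquareSLE`**: eventual tightness of the `ℤ²` walk (stmt-1881)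
and the YB → `ℤ²` toll on bounded Lipschitz functions already give the crux (compare
`TollReduction.surfaceUniversality_of_toll : YBSquareSLE → YBtoUniform → SurfaceUniversality`,
which needs the SLE(8/3) identification of GM's walk to pass the port coupling to the limit).
[folklore] -/
theorem surfaceUniversality_of_tight_of_lipYBtoUniform (hT : SAWParafermion.EventualTight)
    (hU : LipYBtoUniform) : SAWCompassLattice.SurfaceUniversality := by
  refine Surface.surfaceUniversality_iff.2 ?_
  intro α β s z hsol D a b a' b' hab hab' f
  refine tendsto_sub_of_isTightAlongMesh
    (Theorems.SubseqIdentification.Negative.eventually_isProbabilityMeasure_law hab)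
    (Filter.Eventually.of_forall fun δ => SAW.aemeasurable_curve D.carrier δ (a δ) (b δ))
    (hT D a b hab)
    (Surface.eventually_isProbabilityMeasure_compassLaw_of_isCompassSolution hsol D hab')
    (fun g L hg => ?_) f
  have h := (hU D a b a' b' hab hab' g L hg).add (lipPortCoupling hsol D.carrier a' b' g hg)
  rw [add_zero] at h
  exact h.congr fun δ => sub_add_sub_cancel _ _ _

/-- In particular the `C_b` toll of route `SAWTrackTransport` plus `ℤ²` tightness give the crux:
`EventualTight → YBtoUniform → SurfaceUniversality` (no `YBSquareSLE`). [folklore] -/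
theorem surfaceUniversality_of_tight_of_ybToUniform (hT : SAWParafermion.EventualTight)
    (hU : SAWTrackTransport.YBtoUniform) : SAWCompassLattice.SurfaceUniversality :=
  surfaceUniversality_of_tight_of_lipYBtoUniform hT (lipYBtoUniform_of_ybToUniform hU)


end Summit.CriticalPhenomena.SAWScalingLimit.Cruxes.SurfaceUniversality.TightToll

end
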